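import Summits.BirchSwinnertonDyer.BirchSwinnertonDyer.Theorems.EisensteinPrimesSymbolLineRigidity
import Mathlib.LinearAlgebra.FiniteDimensional.Lemmas
import Mathlib.Data.Set.Card
import HarnessLib

/-!
# The MENU of a finite-dimensional space of power series has exactly `ρ` entries: a subspace
# `V ≤ F⟦T⟧` of dimension `ρ` carries exactly `ρ` distinct `T`-orders among its non-zero elements
# (cell `bsd-eis`, seat `bsd-line-x2-p2`, D-0154 KEY row 5; route `EisensteinPrimes`, crux 4 `BSDpOnCellC`
# stmt-BirchSwinnertonDyer-19034 line b1 v10 / crux 3 `MazurMCOnCellB`; third companion of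
# `EisensteinPrimesSymbolLineRigidity` (p606630); memo `HOME/cgshw-MEMO-24.md` §1 NOTATION («the menu
# `Λ(𝔪) := {ord_T L̄(v) : v ∈ 𝒦⁺, L̄(v) ≠ 0}`, `ρ := rank L̄`»), TABLE A (`ρ` by pair) and TABLE M (menus))

HONEST FRAMING (cell `bsd-eis`, run/shared/lean/pub/bsd-eis/): pure linear algebra over a field,
everything PROVED (Mathlib); NO modular symbol, Hecke algebra or `L`-function is constructed or asserted;
nothing is booked; X2 stays CONSTRUCTION-SHAPED; no label or count moves; BSD and Mazur's main
conjecture are proved for no curve.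

## The point

`EisensteinPrimesSymbolLineRigidity` proved «the menu is ONE number iff `ρ ≤ 1`» and «a plane carries
≥ 2 orders». The exact dictionary is: **`#menu = ρ`** — the number of distinct `T`-orders of non-zero
elements of a finite-dimensional subspace `V ≤ F⟦T⟧` equals `dim V` (Gaussian elimination on lowest
coefficients: the minimal order `n₀` is attained, the hyperplane `V ∩ ker(coeff n₀)` has dimension
`dim V − 1` and menu `menu(V) ∖ {n₀}`; induct). For the memo this is the consistency law between TABLE A
(`ρ(N, 𝔪)`, computed as a rank) and TABLE M (menus, read as sets of orders): `ρ = 2` pairs show EXACTLY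
two orders on the image of `L̄` (1020e1: `{2, 4}`), `ρ = 1` pairs exactly one, and a menu with `k`
entries certifies `ρ ≥ k` without computing a rank.

* `exists_min_order` — a non-zero subspace has an element of minimal order.
* **`encard_menu_eq_finrank`** — `#{ord f : f ∈ V ∖ 0} = finrank V` (as `ℕ∞`-cardinality; `V`
  finite-dimensional); `menu_finite`, `ncard_menu_eq_finrank` (the `ℕ` form).
* `encard_menu_apply_eq_finrank_range` — for a linear `M : K → F⟦T⟧` with finite-dimensional image:
  `#{ord (M v) : M v ≠ 0} = finrank (range M)` = `ρ` (MEMO-24's `Λ(𝔪)` and `ρ` literally).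

What this is NOT: not a computation of any `ρ(N, 𝔪)` or menu; not a statement about modular symbols.

References: [Washington1997] §7.1 (`T`-order on `F⟦T⟧`); [EmertonPollackWeston2006] §3 (λ-invariants
along branches — the printed rank-one case; ρ̄ irreducible there, cited for the shape).
-/

set_option autoImplicit false
set_option linter.dupNamespace false

noncomputable section

namespace Summit.BirchSwinnertonDyer.BirchSwinnertonDyer.Theorems.SymbolMenuCard

variable {F : Type*} [Field F]

/-- **A non-zero subspace of `F⟦T⟧` has an element of minimal `T`-order** (orders of non-zero
elements are natural numbers; take the least). [folklore] -/
theorem exists_min_order {V : Submodule F (PowerSeries F)} (hV : V ≠ ⊥) :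
    ∃ f₀ ∈ V, f₀ ≠ 0 ∧ ∀ g ∈ V, g ≠ 0 → f₀.order ≤ g.order := by
  classical
  have hne : ∃ n : ℕ, ∃ f ∈ V, f ≠ 0 ∧ f.order = n := by
    obtain ⟨f, hfV, hf0⟩ := (Submodule.ne_bot_iff V).mp hV
    exact ⟨f.order.toNat, f, hfV, hf0, (PowerSeries.coe_toNat_order hf0).symm⟩
  obtain ⟨f₀, hf₀V, hf₀0, hf₀ord⟩ := Nat.find_spec hne
  refine ⟨f₀, hf₀V, hf₀0, fun g hgV hg0 => ?_⟩
  have hmin : Nat.find hne ≤ g.order.toNat :=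
    Nat.find_min' hne ⟨g, hgV, hg0, (PowerSeries.coe_toNat_order hg0).symm⟩
  rw [hf₀ord, ← PowerSeries.coe_toNat_order hg0]
  exact_mod_cast hmin

/-- The induction behind `encard_menu_eq_finrank`, by strong induction on the dimension `d`:
split off the minimal order `n₀` and pass to the hyperplane `V ∩ ker (coeff n₀)`. [folklore] -/
theorem encard_menu_eq_of_finrank_eq (d : ℕ) :
    ∀ (V : Submodule F (PowerSeries F)) [FiniteDimensional F V], Module.finrank F V = d →
      {n : ℕ∞ | ∃ f ∈ V, f ≠ 0 ∧ f.order = n}.encard = d := by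
  induction d using Nat.strong_induction_on with
  | _ d ih =>
  intro V _ hd
  classical
  by_cases hV : V = ⊥
  · subst hV
    have h0 : d = 0 := by rw [← hd, finrank_bot]
    subst h0
    have hempty : {n : ℕ∞ | ∃ f ∈ (⊥ : Submodule F (PowerSeries F)), f ≠ 0 ∧ f.order = n} = ∅ := by
      ext n
      simp only [Submodule.mem_bot, Set.mem_setOf_eq, Set.mem_empty_iff_false, iff_false]
      rintro ⟨f, rfl, hf0, -⟩
      exact hf0 rfl
    rw [hempty, Set.encard_empty, Nat.cast_zero]
  · obtain ⟨f₀, hf₀V, hf₀0, hmin⟩ := exists_min_order hV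
    set n₀ : ℕ := f₀.order.toNat with hn₀def
    have hn₀ : f₀.order = n₀ := (PowerSeries.coe_toNat_order hf₀0).symm
    have hcoef : PowerSeries.coeff n₀ f₀ ≠ 0 := PowerSeries.coeff_order hf₀0
    -- the hyperplane of elements with vanishing `n₀`-th coefficient
    set V' : Submodule F (PowerSeries F) := V ⊓ LinearMap.ker (PowerSeries.coeff (R := F) n₀)
      with hV'def
    have hV'le : V' ≤ V := inf_le_left
    haveI : FiniteDimensional F V' := Submodule.finiteDimensional_of_le hV'le
    have hmemV' : ∀ g, g ∈ V' ↔ g ∈ V ∧ PowerSeries.coeff n₀ g = 0 := fun g => by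
      rw [hV'def, Submodule.mem_inf, LinearMap.mem_ker]
    -- `V = V' ⊕ F·f₀`
    have hsup : V' ⊔ (F ∙ f₀) = V := by
      refine le_antisymm (sup_le hV'le ((Submodule.span_singleton_le_iff_mem f₀ V).mpr hf₀V)) ?_
      intro g hgV
      set c : F := PowerSeries.coeff n₀ g / PowerSeries.coeff n₀ f₀ with hc
      have h1 : g - c • f₀ ∈ V' := by
        refine (hmemV' _).mpr ⟨V.sub_mem hgV (V.smul_mem c hf₀V), ?_⟩
        rw [map_sub, map_smul, smul_eq_mul, hc, div_mul_cancel₀ _ hcoef, sub_self]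
      have : g = (g - c • f₀) + c • f₀ := by abel
      rw [this]
      exact Submodule.add_mem_sup h1 (Submodule.mem_span_singleton.mpr ⟨c, rfl⟩)
    have hinf : V' ⊓ (F ∙ f₀) = ⊥ := by
      refine eq_bot_iff.mpr fun g hg => ?_
      obtain ⟨hgV', hgspan⟩ := Submodule.mem_inf.mp hg
      obtain ⟨c, rfl⟩ := Submodule.mem_span_singleton.mp hgspan
      have hc0 : c * PowerSeries.coeff n₀ f₀ = 0 := by
        have := ((hmemV' _).mp hgV').2
        rwa [map_smul, smul_eq_mul] at this
      have hc : c = 0 := (mul_eq_zero.mp hc0).resolve_right hcoef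
      rw [hc, zero_smul]
      exact Submodule.zero_mem _
    have hdim : Module.finrank F V' + 1 = d := by
      have h := Submodule.finrank_sup_add_finrank_inf_eq V' (F ∙ f₀)
      rw [hsup, hinf, finrank_bot, add_zero, finrank_span_singleton hf₀0] at h
      omega
    -- the menu splits off `n₀`
    have hnotin : (n₀ : ℕ∞) ∉ {n : ℕ∞ | ∃ f ∈ V', f ≠ 0 ∧ f.order = n} := by
      rintro ⟨g, hgV', hg0, hgord⟩
      have hg := PowerSeries.coeff_order hg0
      have htn : g.order.toNat = n₀ := by rw [hgord]; rfl
      rw [htn] at hg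
      exact hg ((hmemV' g).mp hgV').2
    have hmenu : {n : ℕ∞ | ∃ f ∈ V, f ≠ 0 ∧ f.order = n} =
        insert (n₀ : ℕ∞) {n : ℕ∞ | ∃ f ∈ V', f ≠ 0 ∧ f.order = n} := by
      ext n
      simp only [Set.mem_insert_iff, Set.mem_setOf_eq]
      constructor
      · rintro ⟨g, hgV, hg0, rfl⟩
        by_cases hc : PowerSeries.coeff n₀ g = 0
        · exact Or.inr ⟨g, (hmemV' g).mpr ⟨hgV, hc⟩, hg0, rfl⟩
        · refine Or.inl (le_antisymm (PowerSeries.order_le n₀ hc) ?_)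
          rw [← hn₀]
          exact hmin g hgV hg0
      · rintro (rfl | ⟨g, hgV', hg0, rfl⟩)
        · exact ⟨f₀, hf₀V, hf₀0, hn₀⟩
        · exact ⟨g, hV'le hgV', hg0, rfl⟩
    rw [hmenu, Set.encard_insert_of_notMem hnotin,
      ih (Module.finrank F V') (by omega) V' rfl, ← hdim, Nat.cast_add, Nat.cast_one]

/-- **`#menu = ρ`.** For a finite-dimensional subspace `V ≤ F⟦T⟧`, the set of `T`-orders of its
non-zero elements has exactly `finrank V` elements (as an `ℕ∞`-cardinality). In MEMO-24's terms: the
menu `Λ(𝔪)` of the image of `L̄` has exactly `ρ` entries. [cite: Washington1997, §7.1] -/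
theorem encard_menu_eq_finrank (V : Submodule F (PowerSeries F)) [FiniteDimensional F V] :
    {n : ℕ∞ | ∃ f ∈ V, f ≠ 0 ∧ f.order = n}.encard = Module.finrank F V :=
  encard_menu_eq_of_finrank_eq (Module.finrank F V) V rfl

/-- **The menu is finite** (for `V` finite-dimensional). [folklore] -/
theorem menu_finite (V : Submodule F (PowerSeries F)) [FiniteDimensional F V] :
    {n : ℕ∞ | ∃ f ∈ V, f ≠ 0 ∧ f.order = n}.Finite := by
  rw [← Set.encard_lt_top_iff, encard_menu_eq_finrank V]
  exact ENat.coe_lt_top _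

/-- **`#menu = ρ`, natural-number form.** [cite: Washington1997, §7.1] -/
theorem ncard_menu_eq_finrank (V : Submodule F (PowerSeries F)) [FiniteDimensional F V] :
    {n : ℕ∞ | ∃ f ∈ V, f ≠ 0 ∧ f.order = n}.ncard = Module.finrank F V := by
  rw [Set.ncard_def, encard_menu_eq_finrank V, ENat.toNat_coe]

/-- **A menu with `k` distinct entries certifies `ρ ≥ k`** (read a lower bound for the rank off
observed orders, without computing a rank): if `k` pairwise distinct orders occur among non-zero
elements of `V`, then `k ≤ finrank V`. [folklore] -/
theorem le_finrank_of_orders (V : Submodule F (PowerSeries F)) [FiniteDimensional F V]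
    (S : Finset ℕ∞) (hS : ∀ n ∈ S, ∃ f ∈ V, f ≠ 0 ∧ f.order = n) :
    S.card ≤ Module.finrank F V := by
  have hsub : (S : Set ℕ∞) ⊆ {n : ℕ∞ | ∃ f ∈ V, f ≠ 0 ∧ f.order = n} := fun n hn => hS n hn
  have h := Set.encard_le_encard hsub
  rw [encard_menu_eq_finrank V, Set.encard_coe_eq_coe_finsetCard] at h
  exact_mod_cast h

variable {K : Type*} [AddCommGroup K] [Module F K]

/-- **`#Λ(𝔪) = ρ` literally** (MEMO-24 §1 NOTATION): for a linear `M : K → F⟦T⟧` («`L̄` on `𝒦⁺`»)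
with finite-dimensional image, the menu `{ord_T (M v) : M v ≠ 0}` has exactly
`finrank (range M) = ρ` entries. [cite: Washington1997, §7.1] -/
theorem encard_menu_apply_eq_finrank_range (M : K →ₗ[F] PowerSeries F)
    [FiniteDimensional F (LinearMap.range M)] :
    {n : ℕ∞ | ∃ v : K, M v ≠ 0 ∧ (M v).order = n}.encard =
      Module.finrank F (LinearMap.range M) := by
  rw [← encard_menu_eq_finrank (LinearMap.range M)]
  congr 1
  ext n
  simp only [Set.mem_setOf_eq, LinearMap.mem_range]
  constructor
  · rintro ⟨v, hv, rfl⟩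
    exact ⟨M v, ⟨v, rfl⟩, hv, rfl⟩
  · rintro ⟨f, ⟨v, rfl⟩, hf, rfl⟩
    exact ⟨v, hf, rfl⟩

/-- **When `K` itself is finite-dimensional** (MEMO-24: `𝒦⁺` is a finite `𝔽_p`-space) the image is,
and `#Λ(𝔪) = ρ ≤ dim K`. [folklore] -/
theorem encard_menu_apply_eq_finrank_range' (M : K →ₗ[F] PowerSeries F) [FiniteDimensional F K] :
    {n : ℕ∞ | ∃ v : K, M v ≠ 0 ∧ (M v).order = n}.encard =
        Module.finrank F (LinearMap.range M) ∧
      Module.finrank F (LinearMap.range M) ≤ Module.finrank F K :=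
  ⟨encard_menu_apply_eq_finrank_range M, LinearMap.finrank_range_le M⟩

end Summit.BirchSwinnertonDyer.BirchSwinnertonDyer.Theorems.SymbolMenuCard

end
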